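import Summits.FinalStateConjecture.FinalStateConjecture.Theorems.TameCensorship.Negative.TameGenericityAndFails
import Summits.FinalStateConjecture.FinalStateConjecture.Theses.LogTimeThreeAnnuli
import Literature.Geometry.Lorentzian.TameGenericityDiagonal

/-!
# `SubconvergentEraGeneric` (crux `stmt-FinalStateConjecture-17490`, route `LogTimeThreeAnnuli`,
# rank 5, IMPORT): the countable glue principle behind "`∀ k` inside the generic clause" is false,
# and the crux contains tame weak cosmic censorship verbatim

Negative-side support file of the refuter (crux-attack / vetting seat, 2026-08-17), `sorry`-free,
no named facts, no definitions.

The crux asserts, `Σ` by `Σ`, TAME Christodoulou-genericity (codimension `1`) inside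
`admissibleVacuumData Σ` of ONE property `P D` = "every MGHD of `D` has complete `𝓘⁺` and carries an
honest subconvergent final era", and the era demands `Cᵏ` convergence of the flat zone to `η` and
`Cᵏ` window-closeness of the near zones **for every `k : ℕ`, inside the generic clause**:
`IsTameChristodoulouGeneric 𝓓 (fun D ↦ … ∧ (∀ k, flat k) ∧ (∀ i k ρ ε, near i k ρ ε)) 1`.
The named producers of this IMPORT are indexed the other way round — e.g.
`ClusterCompleteness.OmegaLimitMultiKerr` (stmt-17639) is `∀ k, IsTameChristodoulouGeneric 𝓓 (P k) 1`
(one exceptional set PER order `k`, closeness only frequently-in-`τ`), and the Statement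
`FinalStateConjecture` itself is typed at the single order `k = 2`.

* `isTameChristodoulouGeneric_forall_imp` — the harmless direction: genericity of `∀ k, P k`
  gives genericity of each `P k` (monotonicity); so the crux is the STRONGER side of the interface.
* `not_isTameChristodoulouGeneric_forall_of_admissible` — **the converse glue principle
  "`∀ k`, `P k` tame-generic ⇒ `(∀ k, P k)` tame-generic" is FALSE on the admissible class of
  `ℝ³ = Minkowski.slice` with the summit's notion and codimension** (corollary of the binary failure
  `TameCensorship.Negative.not_isTameChristodoulouGeneric_and_of_admissible`: take `P 0 := PV`,
  `P (k+1) := QH`). Hence no family of `k`-indexed generic producers yields the crux by bookkeeping: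
  a proof must exhibit, through every exceptional datum, ONE tame immersed curve whose members settle
  at ALL orders simultaneously — or the planner restates the era at a fixed finite order `K₀` (the
  derivative budget `DyadicSummability`/`DyadicCapture` actually consume; the flat-zone clause at
  `k ≤ 2` as in the Statement).
* `tameWCC_of_subconvergentEraGeneric`, `tameWCC_exists_of_subconvergentEraGeneric` — the crux
  contains TAME generic weak cosmic censorship outright (with the route's support item `MGHDExists`,
  in the `(∃ MGHD) ∧ ∀ MGHD` shape of the sibling crux `PhaseMixingCapture.WeakCosmicCensorshipTame`,
  stmt-17269, stated inline): every negative result on tame WCC transfers to this crux.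

Nothing here bears on the truth of the crux; it records which reductions are NOT available.
Christodoulou, CQG 16 (1999) A23, p. A24; Ann. Math. 149 (1999) 183, p. 187.
-/

set_option linter.dupNamespace false

noncomputable section

open scoped Manifold ContDiff Topology ENNReal

namespace Summit.FinalStateConjecture.FinalStateConjecture.Theorems.SubconvergentEraGeneric.Negative

open Literature.Geometry.Lorentzian
open Literature.Geometry.Lorentzian.InitialDataSet (IsTameChristodoulouGeneric)
open Summit.FinalStateConjecture.FinalStateConjecture.Theses.LogTimeThreeAnnuli
  (SubconvergentEraGeneric MGHDExists)
open Summit.FinalStateConjecture.FinalStateConjecture.Theorems.TameCensorship.Negative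
  (not_isTameChristodoulouGeneric_and_of_admissible)

section Glue

variable {X : Type} [TopologicalSpace X] [ChartedSpace E3 X] [IsManifold (𝓡 3) ∞ X]

/-- **The harmless direction.** Tame genericity of a countable conjunction gives tame genericity of
each conjunct (monotonicity of `IsTameChristodoulouGeneric` in the property): a crux with `∀ k`
INSIDE the generic clause implies every `k`-indexed version. [cite: Christodoulou1999, p. A24] -/
theorem isTameChristodoulouGeneric_forall_imp {𝓓 : Set (InitialDataSet (𝓡 3) X)} {m : ℕ}
    {P : ℕ → InitialDataSet (𝓡 3) X → Prop}
    (h : IsTameChristodoulouGeneric 𝓓 (fun D ↦ ∀ k, P k D) m) (k : ℕ) :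
    IsTameChristodoulouGeneric 𝓓 (P k) m :=
  h.mono fun _ _ hall ↦ hall k

end Glue

/-- **The countable glue principle is false on the admissible class.** It is NOT true that for
every sequence of properties `P k` of admissible data on `ℝ³`, tame genericity (codimension `1`) of
each `P k` implies tame genericity of `∀ k, P k`: with `P 0 := PV` and `P (k+1) := QH` of
`TameCensorship.Negative.Tame` (both tame-generic inside `admissibleVacuumData Minkowski.slice`,
their conjunction of codimension zero) the conclusion would give tame genericity of `PV ∧ QH`.
Consequence for the crux: `SubconvergentEraGeneric` (order `∀ k` inside the generic clause) is not
obtained from `k`-indexed generic producers such as `ClusterCompleteness.OmegaLimitMultiKerr`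
(`∀ k` outside) by bookkeeping. [cite: Christodoulou1999, p. A24] -/
theorem not_isTameChristodoulouGeneric_forall_of_admissible :
    ¬ ∀ P : ℕ → InitialDataSet (𝓡 3) Minkowski.slice → Prop,
        (∀ k, IsTameChristodoulouGeneric (admissibleVacuumData Minkowski.slice) (P k) 1) →
          IsTameChristodoulouGeneric (admissibleVacuumData Minkowski.slice)
            (fun D ↦ ∀ k, P k D) 1 := by
  intro h
  refine not_isTameChristodoulouGeneric_and_of_admissible fun P Q hP hQ ↦ ?_
  have hR : ∀ k : ℕ, IsTameChristodoulouGeneric (admissibleVacuumData Minkowski.slice)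
      (fun D ↦ (k = 0 → P D) ∧ (k ≠ 0 → Q D)) 1 := by
    intro k
    rcases eq_or_ne k 0 with rfl | hk
    · exact hP.mono fun D _ hPD ↦ ⟨fun _ ↦ hPD, fun h0 ↦ absurd rfl h0⟩
    · exact hQ.mono fun D _ hQD ↦ ⟨fun h0 ↦ absurd h0 hk, fun _ ↦ hQD⟩
  exact (h _ hR).mono fun D _ hall ↦ ⟨(hall 0).1 rfl, (hall 1).2 one_ne_zero⟩

/-- **Witness form**: a sequence of tame-generic (codimension `1`) properties of admissible data on
`ℝ³` whose countable conjunction is not tame-generic. [cite: Christodoulou1999, p. A24] -/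
theorem exists_isTameChristodoulouGeneric_forall_fails :
    ∃ P : ℕ → InitialDataSet (𝓡 3) Minkowski.slice → Prop,
      (∀ k, IsTameChristodoulouGeneric (admissibleVacuumData Minkowski.slice) (P k) 1) ∧
        ¬ IsTameChristodoulouGeneric (admissibleVacuumData Minkowski.slice)
            (fun D ↦ ∀ k, P k D) 1 := by
  by_contra hno
  push Not at hno
  exact not_isTameChristodoulouGeneric_forall_of_admissible fun P hP ↦ hno P hP

/-! ### The crux contains tame weak cosmic censorship -/

/-- **`SubconvergentEraGeneric` implies TAME generic completeness of `𝓘⁺` for every MGHD** (the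
universal conjunct of weak cosmic censorship in Christodoulou's formulation, tame re-type T2),
`Σ` by `Σ`, by monotonicity of tame genericity in the property. [cite: Christodoulou1999, p. A24] -/
theorem tameWCC_of_subconvergentEraGeneric (h : SubconvergentEraGeneric) :
    ∀ (X : Type) [TopologicalSpace X] [ChartedSpace E3 X] [IsManifold (𝓡 3) ∞ X] [T2Space X]
      [SecondCountableTopology X] [ConnectedSpace X],
      IsTameChristodoulouGeneric (admissibleVacuumData X)
        (fun D ↦ ∀ 𝒟 : VacuumCauchyDevelopment D, 𝒟.IsMaximal →
          Summit.FinalStateConjecture.HasCompleteNullInfinity 𝒟.toCauchyDevelopment) 1 := by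
  intro X _ _ _ _ _ _
  exact (h X).mono fun D _ hP 𝒟 h𝒟 ↦ (hP 𝒟 h𝒟).1

/-- **With the route's support item `MGHDExists`, the crux gives tame weak cosmic censorship in the
`(∃ MGHD) ∧ ∀ MGHD` shape** — verbatim the property of the sibling crux
`PhaseMixingCapture.WeakCosmicCensorshipTame` (stmt-FinalStateConjecture-17269), stated inline; so
every refutation or negative lemma on tame WCC transfers to `SubconvergentEraGeneric ∧ MGHDExists`.
[cite: Christodoulou1999, p. A24] -/
theorem tameWCC_exists_of_subconvergentEraGeneric (h : SubconvergentEraGeneric) (hM : MGHDExists) :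
    ∀ (X : Type) [TopologicalSpace X] [ChartedSpace E3 X] [IsManifold (𝓡 3) ∞ X] [T2Space X]
      [SecondCountableTopology X] [ConnectedSpace X],
      IsTameChristodoulouGeneric (admissibleVacuumData X)
        (fun D ↦ (∃ 𝒟 : VacuumCauchyDevelopment D, 𝒟.IsMaximal) ∧
          ∀ 𝒟 : VacuumCauchyDevelopment D, 𝒟.IsMaximal →
            Summit.FinalStateConjecture.HasCompleteNullInfinity 𝒟.toCauchyDevelopment) 1 := by
  intro X _ _ _ _ _ _
  exact (h X).mono fun D hD hP ↦ ⟨hM X D hD, fun 𝒟 h𝒟 ↦ (hP 𝒟 h𝒟).1⟩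

end Summit.FinalStateConjecture.FinalStateConjecture.Theorems.SubconvergentEraGeneric.Negative

end
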